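import Literature.Analysis.SpecialFunctions.OblateSpheroidalSphereBasis
import Literature.Analysis.SpecialFunctions.AssociatedLegendreTheta
import Literature.Analysis.Fourier.PeriodicModeCalculus
import HarnessLib

/-!
# The oblate spheroidal harmonics are weak eigenfunctions of `P(ν)` against `C²` test functions

Dafermos–Rodnianski–Shlapentokh-Rothman, arXiv:1402.7034, §5.2.1 (32) and §5.2.2–§5.2.3: the
oblate spheroidal harmonics `S_{mℓ}(ν, cos θ) e^{imφ}` are eigenfunctions of
`P(ν) = -(1/sin θ)∂_θ(sin θ ∂_θ) - ∂_φ²/sin²θ - ν² cos²θ` on `L²(sin θ dθ dφ)`, and Carter's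
separation (Prop. 5.2.1) is obtained by testing `ρ²□_g ψ` against them and integrating by parts
in `θ, φ`. The tree has the harmonics as an abstract Hilbert basis `Ψ_q = oblateSphereBasis T ν q`
of `L²([-1, 1] × 𝕋)` (`x = cos θ`) with the *weak* eigen-equation against the polynomial core
(`oblateSphere_weak`). This file upgrades the weak equation to **arbitrary `C²` test functions
given in polar coordinates** `g(θ, φ)` (`2π`-periodic in `φ`), in the form needed for the
separation: if `h(θ, φ)` is a continuous function with
`sin²θ · h = -sin θ ∂_θ(sin θ ∂_θ g) - ∂_φ² g` (i.e. `h = -Δ_{S²} g` away from the poles), then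

  `⟪Ψ_q, 𝓛h⟫ - ν² ⟪Ψ_q, cos²θ · 𝓛g⟫ = λ_q(ν) ⟪Ψ_q, 𝓛g⟫`   (`oblateSphere_weak_polar`),

where `𝓛g ∈ L²([-1,1] × 𝕋)` is `(x, φ) ↦ g(arccos x, φ)` (`polarLp`). No regularity of the
abstract eigenfunctions is used: the identity is proved for the unperturbed basis
`Y_{m,k} = e^{(|m|)}_k ⊗ e_m` by the mode calculus in `φ` (`PeriodicModeCalculus`) and Green's
identity in `θ` (`AssociatedLegendreTheta`), and transferred to `Ψ_q` by Parseval in the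
`Y`-basis and the weak equation `oblateSphere_weak`.

Contents: `polarFn`/`polarLp` (+ `measurable`, bound, `coeFn`, `polarLp_apply_coe`),
`inner_tensorLp_left_of_ae_eq` (Fubini form of `⟪f ⊗ e, ·⟫` for an a.e. representative),
`integral_conj_fourierLp_mul` (the `φ`-integral against `e_m` is `(1/T) · modeCoeff`),
`inner_sphHarmTensor_polarLp` (**bridge**: `⟪Y_{m,k}, 𝓛g⟫ = (c_{m,k}/T) ∫_0^π sin θ y_{|m|,k}(θ)
(modeCoeff T m (g θ)) dθ`), `inner_sphHarmTensor_polarLp_laplacian` (`⟪Y, 𝓛h⟫ = Λ ⟪Y, 𝓛g⟫`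
for `T = 2π`), `oblateSphere_weak_polar` (main).

## References

* M. Dafermos, I. Rodnianski, Y. Shlapentokh-Rothman, arXiv:1402.7034, §5.2.1 (32), §5.2.2
  (integration by parts in `θ, φ`), §5.2.3 Prop. 5.2.1. [DafermosRodnianskiShlapentokhrothman2014]
-/

noncomputable section

open MeasureTheory Set Filter Topology Polynomial Real intervalIntegral
open scoped ENNReal ComplexConjugate InnerProductSpace

namespace Literature.Analysis.SpecialFunctions

open Literature.Analysis.FunctionSpaces Literature.Analysis.Fourier

/-! ### Functions in polar coordinates as elements of `L²([-1, 1] × 𝕋)` -/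

section Polar

variable (T : ℝ) [hT : Fact (0 < T)]

/-- **The polar pull-back** `𝓛g (x, φ̄) = g(arccos x, φ)` (`φ ∈ [0, T)` the representative of
`φ̄ ∈ 𝕋_T`) of a function `g(θ, φ)`. [folklore] -/
def polarFn (g : ℝ → ℝ → ℂ) (z : ℝ × AddCircle T) : ℂ :=
  g (arccos z.1) ((AddCircle.equivIco T 0 z.2 : ℝ))

/-- On representatives `φ ∈ [0, T)`: `𝓛g (x, φ) = g(arccos x, φ)`. [folklore] -/
theorem polarFn_apply_coe (g : ℝ → ℝ → ℂ) (x : ℝ) {φ : ℝ} (hφ : φ ∈ Ico 0 T) :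
    polarFn T g (x, (φ : AddCircle T)) = g (arccos x) φ := by
  have h := AddCircle.liftIco_coe_apply (p := T) (a := 0) (f := g (arccos x)) (by rwa [zero_add])
  exact h

/-- Measurability of the polar pull-back of a continuous function. [folklore] -/
theorem measurable_polarFn {g : ℝ → ℝ → ℂ} (hg : Continuous (Function.uncurry g)) :
    Measurable (polarFn T g) := by
  have h1 : Measurable fun z : ℝ × AddCircle T ↦ (arccos z.1, ((AddCircle.equivIco T 0 z.2 : ℝ))) :=
    (continuous_arccos.measurable.comp measurable_fst).prodMk
      (measurable_subtype_coe.comp ((AddCircle.measurableEquivIco T 0).measurable.comp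
        measurable_snd))
  exact hg.measurable.comp h1

/-- A continuous `g` is bounded on `[0, π] × [0, T]`, hence `𝓛g` is bounded. [folklore] -/
theorem exists_bound_polarFn {g : ℝ → ℝ → ℂ} (hg : Continuous (Function.uncurry g)) :
    ∃ C, ∀ z, ‖polarFn T g z‖ ≤ C := by
  obtain ⟨C, hC⟩ := (isCompact_Icc.prod isCompact_Icc :
    IsCompact (Icc (0 : ℝ) π ×ˢ Icc (0 : ℝ) T)).exists_bound_of_continuousOn hg.continuousOn
  refine ⟨C, fun z ↦ ?_⟩
  have hmem := (AddCircle.equivIco T 0 z.2).2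
  refine hC (arccos z.1, _) ⟨⟨arccos_nonneg _, arccos_le_pi _⟩, hmem.1, ?_⟩
  have h2 := hmem.2
  linarith

/-- `𝓛g ∈ L²([-1, 1] × 𝕋)` for continuous `g`. [folklore] -/
theorem memLp_polarFn {g : ℝ → ℝ → ℂ} (hg : Continuous (Function.uncurry g)) :
    MemLp (polarFn T g) 2 (sphereMeasure T) := by
  obtain ⟨C, hC⟩ := exists_bound_polarFn T hg
  exact MemLp.of_bound (measurable_polarFn T hg).aestronglyMeasurable C (ae_of_all _ hC)

/-- **The polar pull-back as an element of `L²([-1, 1] × 𝕋)`.** [folklore] -/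
def polarLp (g : ℝ → ℝ → ℂ) (hg : Continuous (Function.uncurry g)) : Lp ℂ 2 (sphereMeasure T) :=
  (memLp_polarFn T hg).toLp _

/-- The `L²` class is represented by `polarFn`. [folklore] -/
theorem coeFn_polarLp (g : ℝ → ℝ → ℂ) (hg : Continuous (Function.uncurry g)) :
    (polarLp T g hg : ℝ × AddCircle T → ℂ) =ᵐ[sphereMeasure T] polarFn T g :=
  MemLp.coeFn_toLp _

end Polar

/-! ### The pairing with the unperturbed basis in terms of modes -/

section Bridge

variable {T : ℝ} [hT : Fact (0 < T)]

/-- Fubini form of `⟪f ⊗ e, h⟫` for an a.e. representative `H` of `h` with integrable pairing.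
[folklore] -/
theorem inner_tensorLp_left_of_ae_eq (f : Lp ℂ 2 legendreMeasure)
    (e : Lp ℂ 2 (AddCircle.haarAddCircle : Measure (AddCircle T))) (h : Lp ℂ 2 (sphereMeasure T))
    {H : ℝ × AddCircle T → ℂ} (hH : (h : ℝ × AddCircle T → ℂ) =ᵐ[sphereMeasure T] H)
    (hint : Integrable (fun z : ℝ × AddCircle T ↦ conj (f z.1) * (conj (e z.2) * H z))
      (sphereMeasure T)) :
    ⟪tensorLp f e, h⟫_ℂ =
      ∫ x, conj (f x) * ∫ y, conj (e y) * H (x, y) ∂AddCircle.haarAddCircle ∂legendreMeasure := by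
  rw [L2.inner_def]
  calc ∫ z, ⟪(tensorLp f e) z, h z⟫_ℂ ∂sphereMeasure T
      = ∫ z, conj (f z.1) * (conj (e z.2) * H z) ∂sphereMeasure T := by
        refine integral_congr_ae ?_
        filter_upwards [coeFn_tensorLp (𝕜 := ℂ) f e, hH] with z hz hHz
        rw [RCLike.inner_apply, hz, hHz, map_mul]
        ring
    _ = ∫ x, ∫ y, conj (f x) * (conj (e y) * H (x, y)) ∂AddCircle.haarAddCircle ∂legendreMeasure :=
        integral_prod _ hint
    _ = _ := by
        refine integral_congr_ae (ae_of_all _ fun x ↦ ?_)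
        exact integral_const_mul _ _

/-- The `φ`-integral against `e_m` for the Haar probability measure is the normalised mode:
`∫_𝕋 conj(e_m) F dhaar = (1/T) ∫_0^T e_{-m}(φ) F(φ) dφ`. [folklore] -/
theorem integral_conj_fourierLp_mul (m : ℤ) (F : AddCircle T → ℂ) :
    ∫ y, conj ((fourierLp (T := T) 2 m : AddCircle T → ℂ) y) * F y ∂AddCircle.haarAddCircle =
      (1 / T : ℝ) • ∫ φ in (0 : ℝ)..T, fourier (-m) (φ : AddCircle T) * F (φ : AddCircle T) := by
  have h1 :
      ∫ y, conj ((fourierLp (T := T) 2 m : AddCircle T → ℂ) y) * F y ∂AddCircle.haarAddCircle =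
        ∫ y, fourier (-m) y * F y ∂AddCircle.haarAddCircle := by
    refine integral_congr_ae ?_
    filter_upwards [coeFn_fourierLp (T := T) 2 m] with y hy
    rw [hy, fourier_neg]
  rw [h1, integral_haarAddCircle_eq_intervalIntegral]

/-- The mode of the polar pull-back at `x`: `∫_0^T e_{-m} 𝓛g(x, ·) = modeCoeff T m (g (arccos x))`.
[folklore] -/
theorem intervalIntegral_fourier_mul_polarFn (m : ℤ) (g : ℝ → ℝ → ℂ) (x : ℝ) :
    ∫ φ in (0 : ℝ)..T, fourier (-m) (φ : AddCircle T) * polarFn T g (x, (φ : AddCircle T)) =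
      modeCoeff T m (g (arccos x)) := by
  rw [modeCoeff_def]
  have hae : ∀ᵐ φ : ℝ, φ ≠ T := compl_mem_ae_iff.2 (measure_singleton T)
  refine intervalIntegral.integral_congr_ae ?_
  filter_upwards [hae] with φ hne hφ
  rw [uIoc_of_le hT.out.le] at hφ
  rw [polarFn_apply_coe T g x ⟨hφ.1.le, lt_of_le_of_ne hφ.2 hne⟩]

/-- Complex version of the conversion `∫_{[-1,1]} = ∫_{-1}^1`. [folklore] -/
theorem integral_legendreMeasure_eq_intervalIntegral' (f : ℝ → ℂ) :
    ∫ x, f x ∂legendreMeasure = ∫ x in (-1 : ℝ)..1, f x := by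
  rw [intervalIntegral.integral_of_le (by norm_num : (-1 : ℝ) ≤ 1), ← integral_Icc_eq_integral_Ioc]

/-- The associated-Legendre basis function is represented by `c_{m,k} · assocLegFn`. [folklore] -/
theorem coeFn_assocLegBasis (m k : ℕ) :
    (assocLegBasis m k : ℝ → ℂ) =ᵐ[legendreMeasure]
      fun x ↦ (assocLegNormConst m k : ℂ) * assocLegFn m (assocLegPoly m k) x := by
  rw [assocLegBasis_apply]
  filter_upwards [Lp.coeFn_smul (assocLegNormConst m k : ℂ) (assocLegL2 m (assocLegPoly m k)),
    coeFn_assocLegL2 m (assocLegPoly m k)] with x h1 h2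
  rw [h1, Pi.smul_apply, h2, smul_eq_mul]

omit hT in
/-- Continuity of `θ ↦ modeCoeff T m (g θ)` for jointly continuous `g`. [folklore] -/
theorem continuous_modeCoeff_param (m : ℤ) {g : ℝ → ℝ → ℂ} (hg : Continuous (Function.uncurry g)) :
    Continuous fun θ ↦ modeCoeff T m (g θ) := by
  have hc : Continuous
      (Function.uncurry fun (θ : ℝ) (φ : ℝ) ↦ fourier (-m) (φ : AddCircle T) * g θ φ) :=
    (((map_continuous (fourier (-m))).comp (AddCircle.continuous_mk' T)).comp continuous_snd).mul hg
  exact intervalIntegral.continuous_parametric_intervalIntegral_of_continuous' hc 0 T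

/-- **The bridge**: the coefficient of `𝓛g` against `Y_{m,k} = e^{(|m|)}_k ⊗ e_m` is a
`θ`-integral of the `m`-th mode of `g`:
`⟪Y_{m,k}, 𝓛g⟫ = (c_{|m|,k}/T) ∫_0^π sin θ · y_{|m|,k}(θ) · modeCoeff T m (g θ) dθ`. [folklore] -/
theorem inner_sphHarmTensor_polarLp (m : ℤ) (k : ℕ) (g : ℝ → ℝ → ℂ)
    (hg : Continuous (Function.uncurry g)) :
    ⟪sphHarmTensor T m k, polarLp T g hg⟫_ℂ =
      ((assocLegNormConst m.natAbs k / T : ℝ) : ℂ) *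
        ∫ θ in (0 : ℝ)..π, ((sin θ * thetaFn m.natAbs (assocLegPoly m.natAbs k) θ : ℝ) : ℂ) *
          modeCoeff T m (g θ) := by
  set n := m.natAbs with hn
  set f : Lp ℂ 2 legendreMeasure := assocLegBasis n k with hf
  set e : Lp ℂ 2 (AddCircle.haarAddCircle : Measure (AddCircle T)) := fourierLp (T := T) 2 m
    with he
  obtain ⟨C, hC⟩ := exists_bound_polarFn T hg
  -- integrability of the pairing
  have hint : Integrable (fun z : ℝ × AddCircle T ↦ conj (f z.1) * (conj (e z.2) * polarFn T g z))
      (sphereMeasure T) := by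
    have hF : Integrable (fun z : ℝ × AddCircle T ↦ f z.1 * e z.2) (sphereMeasure T) :=
      (memLp_two_tensor f e).integrable one_le_two
    refine (hF.norm.const_mul C).mono' ?_ ?_
    · exact ((RCLike.continuous_conj.comp_aestronglyMeasurable (Lp.memLp f).1.comp_fst).mul
        ((RCLike.continuous_conj.comp_aestronglyMeasurable (Lp.memLp e).1.comp_snd).mul
          (measurable_polarFn T hg).aestronglyMeasurable))
    · refine ae_of_all _ fun z ↦ ?_
      rw [norm_mul, norm_mul, norm_mul, RCLike.norm_conj, RCLike.norm_conj, ← mul_assoc]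
      have h0 : 0 ≤ ‖f z.1‖ * ‖e z.2‖ := by positivity
      calc ‖f z.1‖ * ‖e z.2‖ * ‖polarFn T g z‖ ≤ ‖f z.1‖ * ‖e z.2‖ * C :=
            mul_le_mul_of_nonneg_left (hC z) h0
        _ = C * (‖f z.1‖ * ‖e z.2‖) := by ring
  rw [sphHarmTensor, ← hf, ← he, inner_tensorLp_left_of_ae_eq f e _ (coeFn_polarLp T g hg) hint]
  -- the inner integral is the mode
  have hinner : ∀ x, (∫ y, conj (e y) * polarFn T g (x, y) ∂AddCircle.haarAddCircle) =
      ((1 / T : ℝ) : ℂ) * modeCoeff T m (g (arccos x)) := fun x ↦ by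
    rw [he, integral_conj_fourierLp_mul, intervalIntegral_fourier_mul_polarFn, Complex.real_smul]
  simp_rw [hinner]
  -- the outer integral over `[-1, 1]`
  have hmode : Continuous fun x ↦ modeCoeff T m (g (arccos x)) :=
    (continuous_modeCoeff_param m hg).comp continuous_arccos
  have hG : Continuous fun x ↦ assocLegFn n (assocLegPoly n k) x * modeCoeff T m (g (arccos x)) :=
    (continuous_assocLegFn n _).mul hmode
  calc ∫ x, conj (f x) * (((1 / T : ℝ) : ℂ) * modeCoeff T m (g (arccos x))) ∂legendreMeasure
      = ∫ x, ((assocLegNormConst n k / T : ℝ) : ℂ) *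
          (assocLegFn n (assocLegPoly n k) x * modeCoeff T m (g (arccos x))) ∂legendreMeasure := by
        refine integral_congr_ae ?_
        filter_upwards [coeFn_assocLegBasis n k] with x hx
        rw [hf, hx, map_mul, Complex.conj_ofReal, assocLegFn_apply, Complex.conj_ofReal]
        push_cast
        ring
    _ = ((assocLegNormConst n k / T : ℝ) : ℂ) *
          ∫ x in (-1 : ℝ)..1, assocLegFn n (assocLegPoly n k) x * modeCoeff T m (g (arccos x)) := by
        rw [MeasureTheory.integral_const_mul, integral_legendreMeasure_eq_intervalIntegral']
    _ = ((assocLegNormConst n k / T : ℝ) : ℂ) *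
          ∫ θ in (0 : ℝ)..π, (sin θ : ℂ) *
            (assocLegFn n (assocLegPoly n k) (cos θ) * modeCoeff T m (g (arccos (cos θ)))) := by
        rw [← integral_comp_cos hG]
    _ = _ := by
        congr 1
        refine integral_congr fun θ hθ ↦ ?_
        rw [uIcc_of_le pi_pos.le] at hθ
        rw [arccos_cos hθ.1 hθ.2, ← thetaFn_eq_assocLegFn n _ hθ]
        push_cast
        ring

end Bridge

/-! ### The Laplacian identity for the unperturbed basis (`T = 2π`) -/

section Laplacian

variable [h2π : Fact (0 < 2 * π)]

omit h2π in
/-- `(m.natAbs : ℝ)² = (m : ℝ)²`. [folklore] -/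
theorem natAbs_sq_cast (m : ℤ) : ((m.natAbs : ℕ) : ℝ) ^ 2 = (m : ℝ) ^ 2 := by
  rw [Nat.cast_natAbs, Int.cast_abs, sq_abs]

/-- **The modes of a `C²` function in polar coordinates satisfy the associated-Legendre Green
identity.** Data: `g` with `θ`-derivative `gθ`, `w = ∂_θ(sin θ · gθ)`, `φ`-derivatives `gφ`,
`gφφ`, all jointly continuous and `2π`-periodic in `φ`, and a continuous `h` with
`sin²θ · h = -sin θ · w - gφφ` (so `h = -Δ_{S²} g` off the poles). Then for every `m, k`:
`∫_0^π sin θ · y_{|m|,k}(θ) · H_m(θ) dθ = Λ_{|m|,k} ∫_0^π sin θ · y_{|m|,k}(θ) · G_m(θ) dθ`, where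
`G_m, H_m` are the `m`-th `φ`-modes of `g, h`.
[cite: DafermosRodnianskiShlapentokhrothman2014, §5.2.2] -/
theorem intervalIntegral_mode_laplacian (m : ℤ) (k : ℕ) {g gθ w gφ gφφ h : ℝ → ℝ → ℂ}
    (hgθ : ∀ θ φ, HasDerivAt (fun θ ↦ g θ φ) (gθ θ φ) θ)
    (hw : ∀ θ φ, HasDerivAt (fun θ ↦ (sin θ : ℂ) * gθ θ φ) (w θ φ) θ)
    (hgφ : ∀ θ φ, HasDerivAt (g θ) (gφ θ φ) φ)
    (hgφφ : ∀ θ φ, HasDerivAt (gφ θ) (gφφ θ φ) φ)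
    (hcg : Continuous (Function.uncurry g)) (hcgθ : Continuous (Function.uncurry gθ))
    (hcw : Continuous (Function.uncurry w)) (hcgφφ : Continuous (Function.uncurry gφφ))
    (hper : ∀ θ φ, g θ (φ + 2 * π) = g θ φ) (hperφ : ∀ θ φ, gφ θ (φ + 2 * π) = gφ θ φ)
    (hrel : ∀ θ φ, (sin θ : ℂ) ^ 2 * h θ φ = -(sin θ : ℂ) * w θ φ - gφφ θ φ) :
    ∫ θ in (0 : ℝ)..π, ((sin θ * thetaFn m.natAbs (assocLegPoly m.natAbs k) θ : ℝ) : ℂ) *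
        modeCoeff (2 * π) m (h θ) =
      (assocLegLevel m.natAbs k : ℂ) *
        ∫ θ in (0 : ℝ)..π, ((sin θ * thetaFn m.natAbs (assocLegPoly m.natAbs k) θ : ℝ) : ℂ) *
          modeCoeff (2 * π) m (g θ) := by
  set n := m.natAbs with hn
  set q := assocLegPoly n k with hq
  -- the modes and their `θ`-derivatives
  set G : ℝ → ℂ := fun θ ↦ modeCoeff (2 * π) m (g θ) with hG
  set G' : ℝ → ℂ := fun θ ↦ modeCoeff (2 * π) m (gθ θ) with hG'
  set W : ℝ → ℂ := fun θ ↦ modeCoeff (2 * π) m (w θ) with hW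
  set H : ℝ → ℂ := fun θ ↦ modeCoeff (2 * π) m (h θ) with hH
  have hG₁ : ∀ θ, HasDerivAt G (G' θ) θ := fun θ ↦
    hasDerivAt_modeCoeff_param m hgθ hcg hcgθ θ
  have hG₂ : ∀ θ, HasDerivAt (fun θ ↦ (sin θ : ℂ) * G' θ) (W θ) θ := by
    intro θ
    have hfun : (fun θ ↦ (sin θ : ℂ) * G' θ) =
        fun θ ↦ modeCoeff (2 * π) m (fun φ ↦ (sin θ : ℂ) * gθ θ φ) := by
      funext θ
      rw [hG', modeCoeff_const_mul]
    rw [hfun]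
    exact hasDerivAt_modeCoeff_param m (G := fun θ φ ↦ (sin θ : ℂ) * gθ θ φ) hw
      ((Complex.continuous_ofReal.comp (continuous_sin.comp continuous_fst)).mul hcgθ) hcw θ
  have hG'c : Continuous G' := continuous_modeCoeff_param m hcgθ
  have hWc : Continuous W := continuous_modeCoeff_param m hcw
  -- the `φφ`-mode: `mode(gφφ) = -m² G`
  have hφφ : ∀ θ, modeCoeff (2 * π) m (gφφ θ) = -((m : ℝ) ^ 2 : ℝ) * G θ := by
    intro θ
    have h := modeCoeff_hasDerivAt_hasDerivAt_eq (T := 2 * π) m (fun φ _ ↦ hgφ θ φ)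
      (fun φ _ ↦ hgφφ θ φ)
      ((hcgφφ.comp (continuous_const.prodMk continuous_id)).intervalIntegrable _ _)
      (by simpa using hper θ 0) (by simpa using hperφ θ 0)
    rw [h]
    congr 2
    have hπ : (2 * π : ℝ) ≠ 0 := by positivity
    field_simp
  -- the mode of the relation: `sin²θ H = -sin θ W + m² G`
  have hmode : ∀ θ, (sin θ : ℂ) ^ 2 * H θ = -(sin θ : ℂ) * W θ + ((m : ℝ) ^ 2 : ℝ) * G θ := by
    intro θ
    have hi1 : IntervalIntegrable (fun φ ↦ -(sin θ : ℂ) * w θ φ) volume 0 (2 * π) :=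
      ((hcw.comp (continuous_const.prodMk continuous_id)).const_mul _).intervalIntegrable _ _
    have hi2 : IntervalIntegrable (fun φ ↦ -gφφ θ φ) volume 0 (2 * π) :=
      (hcgφφ.comp (continuous_const.prodMk continuous_id)).neg.intervalIntegrable _ _
    have h1 : modeCoeff (2 * π) m (fun φ ↦ (sin θ : ℂ) ^ 2 * h θ φ) =
        modeCoeff (2 * π) m (fun φ ↦ -(sin θ : ℂ) * w θ φ + -gφφ θ φ) := by
      simp only [modeCoeff_def]
      refine integral_congr fun φ _ ↦ ?_
      rw [hrel θ φ, sub_eq_add_neg]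
    rw [modeCoeff_const_mul, modeCoeff_add m hi1 hi2, modeCoeff_const_mul,
      show (fun φ ↦ -gφφ θ φ) = fun φ ↦ (-1 : ℂ) * gφφ θ φ from funext fun _ ↦ by ring,
      modeCoeff_const_mul, hφφ] at h1
    rw [hH, hW]
    linear_combination h1
  -- pointwise on `(0, π]` minus the endpoint: the integrand of Green's identity
  have hpt : ∀ θ, sin θ ≠ 0 →
      ((sin θ * thetaFn n q θ : ℝ) : ℂ) * H θ =
        -(thetaFn n q θ : ℂ) * W θ +
          ((((n : ℕ) : ℝ) ^ 2 * sin θ ^ (n - 1) * q.eval (cos θ) : ℝ) : ℂ) * G θ := by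
    intro θ hs
    have hs' : (sin θ : ℂ) ≠ 0 := by exact_mod_cast hs
    apply mul_left_cancel₀ hs'
    have key := hmode θ
    have hpow : ((n : ℕ) : ℝ) ^ 2 * sin θ ^ (n - 1) * sin θ = (m : ℝ) ^ 2 * sin θ ^ n := by
      rw [natAbs_sq_cast]
      rcases Nat.eq_zero_or_pos n with h0 | hpos
      · have hm : m = 0 := Int.natAbs_eq_zero.1 (hn ▸ h0)
        simp [hm]
      · rw [mul_assoc, ← pow_succ, Nat.sub_add_cancel hpos]
    have hpow' : ((n : ℕ) : ℂ) ^ 2 * (sin θ : ℂ) ^ (n - 1) * (sin θ : ℂ) =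
        ((m : ℝ) : ℂ) ^ 2 * (sin θ : ℂ) ^ n := by
      have := congrArg (fun r : ℝ ↦ (r : ℂ)) hpow
      simpa only [Complex.ofReal_mul, Complex.ofReal_pow, Complex.ofReal_natCast,
        Complex.ofReal_intCast] using this
    simp only [Complex.ofReal_pow] at key
    simp only [thetaFn, Complex.ofReal_mul, Complex.ofReal_pow, Complex.ofReal_natCast]
    linear_combination ((sin θ : ℂ) ^ n * ((q.eval (cos θ) : ℝ) : ℂ)) * key -
      (((q.eval (cos θ) : ℝ) : ℂ) * G θ) * hpow'
  -- Green's identity in `θ`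
  have green := thetaGreen_eigen n k (h := G) (h' := G') (w := W) (fun θ _ ↦ hG₁ θ)
    (fun θ _ ↦ hG₂ θ) hG'c.continuousOn (hWc.intervalIntegrable _ _)
  rw [← green]
  have hae : ∀ᵐ θ : ℝ, θ ≠ π := compl_mem_ae_iff.2 (measure_singleton π)
  refine intervalIntegral.integral_congr_ae ?_
  filter_upwards [hae] with θ hne hθ
  rw [uIoc_of_le pi_pos.le] at hθ
  have hs : sin θ ≠ 0 := (sin_pos_of_pos_of_lt_pi hθ.1 (lt_of_le_of_ne hθ.2 hne)).ne'
  rw [hq] at hpt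
  exact hpt θ hs

/-- **`⟪Y_{m,k}, 𝓛h⟫ = Λ_{|m|,k} ⟪Y_{m,k}, 𝓛g⟫`** for the unperturbed basis `Y_{m,k}` and a `C²`
function `g` in polar coordinates with Laplacian data `h` (hypotheses as in
`intervalIntegral_mode_laplacian`). [cite: DafermosRodnianskiShlapentokhrothman2014, §5.2.2] -/
theorem inner_sphHarmTensor_polarLp_laplacian (m : ℤ) (k : ℕ) {g gθ w gφ gφφ h : ℝ → ℝ → ℂ}
    (hgθ : ∀ θ φ, HasDerivAt (fun θ ↦ g θ φ) (gθ θ φ) θ)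
    (hw : ∀ θ φ, HasDerivAt (fun θ ↦ (sin θ : ℂ) * gθ θ φ) (w θ φ) θ)
    (hgφ : ∀ θ φ, HasDerivAt (g θ) (gφ θ φ) φ)
    (hgφφ : ∀ θ φ, HasDerivAt (gφ θ) (gφφ θ φ) φ)
    (hcg : Continuous (Function.uncurry g)) (hcgθ : Continuous (Function.uncurry gθ))
    (hcw : Continuous (Function.uncurry w)) (hcgφφ : Continuous (Function.uncurry gφφ))
    (hch : Continuous (Function.uncurry h))
    (hper : ∀ θ φ, g θ (φ + 2 * π) = g θ φ) (hperφ : ∀ θ φ, gφ θ (φ + 2 * π) = gφ θ φ)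
    (hrel : ∀ θ φ, (sin θ : ℂ) ^ 2 * h θ φ = -(sin θ : ℂ) * w θ φ - gφφ θ φ) :
    ⟪sphHarmTensor (2 * π) m k, polarLp (2 * π) h hch⟫_ℂ =
      (assocLegLevel m.natAbs k : ℂ) * ⟪sphHarmTensor (2 * π) m k, polarLp (2 * π) g hcg⟫_ℂ := by
  rw [inner_sphHarmTensor_polarLp, inner_sphHarmTensor_polarLp,
    intervalIntegral_mode_laplacian m k hgθ hw hgφ hgφφ hcg hcgθ hcw hcgφφ hper hperφ hrel]
  ring

/-- **The oblate spheroidal harmonics are weak eigenfunctions of `P(ν)` against every `C²` test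
function in polar coordinates**: with `g`, `h` as above (so `h = -Δ_{S²}g` off the poles) and
`Ψ_q = oblateSphereBasis (2π) ν q`,
`⟪Ψ_q, 𝓛h⟫ - ν² ⟪Ψ_q, cos²θ · 𝓛g⟫ = λ_q(ν) ⟪Ψ_q, 𝓛g⟫`, i.e. `⟪Ψ_q, 𝓛(P(ν) g)⟫ = λ_q ⟪Ψ_q, 𝓛g⟫`.
[cite: DafermosRodnianskiShlapentokhrothman2014, §5.2.1 (32)] -/
theorem oblateSphere_weak_polar (ν : ℝ) (p : OblateSphereIndex ν) {g gθ w gφ gφφ h : ℝ → ℝ → ℂ}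
    (hgθ : ∀ θ φ, HasDerivAt (fun θ ↦ g θ φ) (gθ θ φ) θ)
    (hw : ∀ θ φ, HasDerivAt (fun θ ↦ (sin θ : ℂ) * gθ θ φ) (w θ φ) θ)
    (hgφ : ∀ θ φ, HasDerivAt (g θ) (gφ θ φ) φ)
    (hgφφ : ∀ θ φ, HasDerivAt (gφ θ) (gφφ θ φ) φ)
    (hcg : Continuous (Function.uncurry g)) (hcgθ : Continuous (Function.uncurry gθ))
    (hcw : Continuous (Function.uncurry w)) (hcgφφ : Continuous (Function.uncurry gφφ))
    (hch : Continuous (Function.uncurry h))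
    (hper : ∀ θ φ, g θ (φ + 2 * π) = g θ φ) (hperφ : ∀ θ φ, gφ θ (φ + 2 * π) = gφ θ φ)
    (hrel : ∀ θ φ, (sin θ : ℂ) ^ 2 * h θ φ = -(sin θ : ℂ) * w θ φ - gφφ θ φ) :
    ⟪oblateSphereBasis (2 * π) ν p, polarLp (2 * π) h hch⟫_ℂ -
        ((ν ^ 2 : ℝ) : ℂ) *
          ⟪oblateSphereBasis (2 * π) ν p, mulSqFst (2 * π) (polarLp (2 * π) g hcg)⟫_ℂ =
      (oblateSphereEig ν p : ℂ) * ⟪oblateSphereBasis (2 * π) ν p, polarLp (2 * π) g hcg⟫_ℂ := by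
  obtain ⟨b, hb⟩ := exists_hilbertBasis_sphHarmTensor (T := 2 * π)
  -- Parseval in the `Y`-basis
  have P1 := b.hasSum_inner_mul_inner (oblateSphereBasis (2 * π) ν p) (polarLp (2 * π) h hch)
  have P2 := b.hasSum_inner_mul_inner (oblateSphereBasis (2 * π) ν p) (polarLp (2 * π) g hcg)
  have P3 := b.hasSum_inner_mul_inner (mulSqFst (2 * π) (oblateSphereBasis (2 * π) ν p))
    (polarLp (2 * π) g hcg)
  -- termwise identity
  have hterm : ∀ r : (Σ _ : ℤ, ℕ),
      ⟪oblateSphereBasis (2 * π) ν p, b r⟫_ℂ * ⟪b r, polarLp (2 * π) h hch⟫_ℂ =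
      (oblateSphereEig ν p : ℂ) *
          (⟪oblateSphereBasis (2 * π) ν p, b r⟫_ℂ * ⟪b r, polarLp (2 * π) g hcg⟫_ℂ) +
        ((ν ^ 2 : ℝ) : ℂ) * (⟪mulSqFst (2 * π) (oblateSphereBasis (2 * π) ν p), b r⟫_ℂ *
          ⟪b r, polarLp (2 * π) g hcg⟫_ℂ) := by
    intro r
    rw [hb r, inner_sphHarmTensor_polarLp_laplacian r.1 r.2 hgθ hw hgφ hgφφ hcg hcgθ hcw hcgφφ
      hch hper hperφ hrel]
    -- conjugate of the weak equation in the `Y`-basis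
    have hweak := oblateSphere_weak (T := 2 * π) ν p r.1 r.2
    have hconj := congrArg conj hweak
    simp only [map_sub, map_mul, Complex.conj_ofReal, inner_conj_symm] at hconj
    rw [inner_mulSqFst_comm]
    rw [inner_mulSqFst_comm] at hconj
    linear_combination ⟪sphHarmTensor (2 * π) r.1 r.2, polarLp (2 * π) g hcg⟫_ℂ * hconj
  have hfun : (fun r : (Σ _ : ℤ, ℕ) ↦
      ⟪oblateSphereBasis (2 * π) ν p, b r⟫_ℂ * ⟪b r, polarLp (2 * π) h hch⟫_ℂ) =
      fun r ↦ (oblateSphereEig ν p : ℂ) *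
          (⟪oblateSphereBasis (2 * π) ν p, b r⟫_ℂ * ⟪b r, polarLp (2 * π) g hcg⟫_ℂ) +
        ((ν ^ 2 : ℝ) : ℂ) * (⟪mulSqFst (2 * π) (oblateSphereBasis (2 * π) ν p), b r⟫_ℂ *
          ⟪b r, polarLp (2 * π) g hcg⟫_ℂ) := funext hterm
  rw [hfun] at P1
  have P4 := (P2.mul_left (oblateSphereEig ν p : ℂ)).add (P3.mul_left (((ν ^ 2 : ℝ) : ℂ)))
  have heq := P1.unique P4
  rw [inner_mulSqFst_comm] at heq
  linear_combination heq

end Laplacian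

end Literature.Analysis.SpecialFunctions
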